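import Summits.RiemannHypothesis.RiemannHypothesis.Theorems.SemilocalNegCertTwentyNineKinked1723
import HarnessLib

/-!
# Semi-local threshold of the `{∞,2,…,29}` form, negative side: `a*({2,…,29}) ≤ 441/256 (= 1764/1024)` — the wall `q = 31` from a KINKED (piecewise-cubic) witness with a reduced kink set (part 2/17: the kernel facts piece 12 … piece 23 of 180 (imports part 1 only))

Cell `rh-explicit` (HOME `run/shared/lean/pub/rh-explicit/`), seat cc-s2-9 gen0 (HUMAN RULING D-0074 (D5) WEIL data engine; LADDER-RH column WEIL, rung DATA → W-P(P2);
pipeline = cc-s2-4 gen8/gen11's piecewise-witness layer `SemilocalPiecewise{Witness,Increment,IncrementSum,Cert}.lean` + their float finder, every number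
re-derived by an independent second engine E2 before filing).  HONEST FRAMING: RH-FREE theorems about the tree's `weilSemilocalThreshold S` of a
TRUNCATED Weil form (finitely many places); nothing here bears on the truth of RH; the lower clause `(log q)/2 ≤ a*(S_q)` at all primes IS RH and is untouched.

Fifth kinked row of this seat.  REDUCED KINK SET (kit j250048, two engines): at `b = 441/256 = a*(S_31) + 0.0056` the slope breaks at the images of the TWELVE atoms
`2, 3, 4, 5, 7, 9, 11, 13, 17, 19, 23, 29` (images of `8, 16, 25, 27` dropped) give `λ_min = −4.209·10⁻³` (all sixteen: `−8.48·10⁻³`; ten: `−4.4·10⁻⁴`); the tree's polynomial row is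
`443/256` (`SemilocalNegCertTwentyNineLight`, `δ*(31) ≤ 0.0134`).  Instance: `S = {2,…,29}`, `N = 31` (atom table `atomsTwentyNineL` / `atomsEnclose_TwentyNineL`), 13 pieces of degree ≤ 3;
TWO ENGINES on the witness: cc-s2-4's float finder `−4.2091·10⁻³`, E2 `−4.2051·10⁻³` (no polar credit); exact kernel margin `(rhs − lhs)/‖G‖² = 4.191e-03` (farm report, 180 `t`-pieces).
⇒ **`a*({2,…,29}) ≤ 441/256`, `δ*(31) ≤ 0.00567`** (was `0.0134`); DATA: `a*(S_31) = 1.7171`, `δ*(31) ≈ 1.1·10⁻⁴`.  No data is trusted: every bound is a `decide +kernel` fact.  Folklore throughout.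
-/

set_option autoImplicit false
set_option linter.dupNamespace false  -- the mandated namespace repeats `RiemannHypothesis`
set_option Elab.async false  -- serialise the kernel facts: in parallel they exhaust the node's per-process heap (cc-s2-4 gen11, CC4-LEAN §16.10)

noncomputable section

open Complex Filter Set MeasureTheory Topology
open scoped Real

namespace Summit.RiemannHypothesis.RiemannHypothesis.Theorems.SemilocalPolyWitness

open MeasureTheory Set Finset Real
open Literature.NumberTheory.LFunctions
open Summit.RiemannHypothesis.RiemannHypothesis.Theorems.MotivicDoor
open Summit.RiemannHypothesis.RiemannHypothesis.Theorems.MotivicDoor.SemilocalThreshold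
open Summit.RiemannHypothesis.RiemannHypothesis.Theorems.MotivicDoor.SemilocalMarkov
open LQ

set_option maxHeartbeats 0 in
/-- kernel fact: piece `12` of `certTwentyNineKinked1723`. -/
theorem check_TwentyNineKinked1723_piece12 : certTwentyNineKinked1723.checkPiecePW 12 = true := by
  decide +kernel

set_option maxHeartbeats 0 in
/-- kernel fact: piece `13` of `certTwentyNineKinked1723`. -/
theorem check_TwentyNineKinked1723_piece13 : certTwentyNineKinked1723.checkPiecePW 13 = true := by
  decide +kernel

set_option maxHeartbeats 0 in
/-- kernel fact: piece `14` of `certTwentyNineKinked1723`. -/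
theorem check_TwentyNineKinked1723_piece14 : certTwentyNineKinked1723.checkPiecePW 14 = true := by
  decide +kernel

set_option maxHeartbeats 0 in
/-- kernel fact: piece `15` of `certTwentyNineKinked1723`. -/
theorem check_TwentyNineKinked1723_piece15 : certTwentyNineKinked1723.checkPiecePW 15 = true := by
  decide +kernel

set_option maxHeartbeats 0 in
/-- kernel fact: piece `16` of `certTwentyNineKinked1723`. -/
theorem check_TwentyNineKinked1723_piece16 : certTwentyNineKinked1723.checkPiecePW 16 = true := by
  decide +kernel

set_option maxHeartbeats 0 in
/-- kernel fact: piece `17` of `certTwentyNineKinked1723`. -/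
theorem check_TwentyNineKinked1723_piece17 : certTwentyNineKinked1723.checkPiecePW 17 = true := by
  decide +kernel

set_option maxHeartbeats 0 in
/-- kernel fact: piece `18` of `certTwentyNineKinked1723`. -/
theorem check_TwentyNineKinked1723_piece18 : certTwentyNineKinked1723.checkPiecePW 18 = true := by
  decide +kernel

set_option maxHeartbeats 0 in
/-- kernel fact: piece `19` of `certTwentyNineKinked1723`. -/
theorem check_TwentyNineKinked1723_piece19 : certTwentyNineKinked1723.checkPiecePW 19 = true := by
  decide +kernel

set_option maxHeartbeats 0 in
/-- kernel fact: piece `20` of `certTwentyNineKinked1723`. -/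
theorem check_TwentyNineKinked1723_piece20 : certTwentyNineKinked1723.checkPiecePW 20 = true := by
  decide +kernel

set_option maxHeartbeats 0 in
/-- kernel fact: piece `21` of `certTwentyNineKinked1723`. -/
theorem check_TwentyNineKinked1723_piece21 : certTwentyNineKinked1723.checkPiecePW 21 = true := by
  decide +kernel

set_option maxHeartbeats 0 in
/-- kernel fact: piece `22` of `certTwentyNineKinked1723`. -/
theorem check_TwentyNineKinked1723_piece22 : certTwentyNineKinked1723.checkPiecePW 22 = true := by
  decide +kernel

set_option maxHeartbeats 0 in
/-- kernel fact: piece `23` of `certTwentyNineKinked1723`. -/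
theorem check_TwentyNineKinked1723_piece23 : certTwentyNineKinked1723.checkPiecePW 23 = true := by
  decide +kernel

end Summit.RiemannHypothesis.RiemannHypothesis.Theorems.SemilocalPolyWitness

end
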